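/-
Copyright (c) 2026 the pub-hodgecm-mathlib formalisation cell (harness21).  Prover seat hodgecm-mathlib-K2E3-p20 (g0),
Track B «K2-LIT» ∕ h413, line `K2_E3_EllipticInputs`, unit U5Kazhdan, socket #20P (DISC-PL) — MEMO-20P-road §3 S2, docking: «L² irreducible ⇒
unitarisable with L² coefficients» and THE FORMAL DEGREE OF AN `L²` CLASS of `U(Φ₃)(L⁺_v)`.  2026-09-03.
-/
import Summits.HodgeConjecture.HodgeConjecture.Theorems.K2E3SchurOrthogonalitySquareIntegrable   -- ★ p855390: Thm 1 (a) for `L²` coefficients, `exists_formalDegree_of_memLp` (brings ★ SquareIntegrableModCompactCenter, ★ p855232)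
import Literature.NumberTheory.Automorphic.GodementJacquetLocalNonvanishing                    -- ★ `exists_mem_contragredient_apply_ne_zero` (the smooth contragredient separates points)
import Literature.NumberTheory.Automorphic.MatrixCoefficientsSupercuspidalAdmissibleProofs      -- ★ `IsIrreducible.span_orbit_eq_top`
import HarnessLib

/-!
# K2_E3 road (h413 = stmt-HodgeConjecture-24833), socket #20P «DISC-PL» — S2 «formalDegreeL2», docking: THE FORMAL DEGREE `d(π) > 0` OF A
# SQUARE-INTEGRABLE CLASS OF `U(Φ₃)(L⁺_v)` EXISTS AND IS CANONICAL (Harish-Chandra 1970, Part I §1 Theorem 1)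

Cell `pub/hodgecm-mathlib` (D-0151), Track B, line `Summits/HodgeConjecture/HodgeConjecture/Cruxes/H413/Lines/K2_E3_EllipticInputs.lean`, unit U5Kazhdan,
socket #20P `sig_K2E3DiscretePlancherelCuspidal` (annex `…Sigs_U5bWildPlancherel.lean` :144; MEMO-20P-road 6ab33264ff32dae1 §3 S2).  Helper file (`--supports
stmt-HodgeConjecture-24833 --as helper`, no socket closed); THEOREMS ONLY (no `def`, no instance, no notation, no named fact, no `sorry`); ★-only imports.

THE POINT.  ★ p855390 `exists_formalDegree_of_memLp` gives, for every class `π`, ONE `d > 0` equal to `(re B v v)² ∕ ∫ ‖B (r.ρ x v) v‖²` for every `L²` datum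
`(r, B, v)` of `π` — vacuous unless such a datum EXISTS.  For a class that is square-integrable modulo the centre in the tree's sense (★
`IrrClass.IsSquareIntegrable μZ`: some representative has every smooth coefficient dominated by an `L²(G ∕ Z)` function; here `μZ` the push-forward of `νQv`)
this file PRODUCES the datum: §1 (generic) an irreducible smooth `ρ` with a smooth functional `φ₀ ≠ 0` whose coefficients `x ↦ φ₀ (ρ x v)` are in `L²(G, ν)`
(`ν` right-invariant) carries the invariant positive-definite Hermitian form `B(v, w) = ∫ conj (φ₀ (ρ x v)) · φ₀ (ρ x w) dν` («`L²` ⇒ unitarisable»: invariance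
by right invariance of `ν`; definiteness because `x ↦ φ₀ (ρ x v)` is continuous, and `≢ 0` for `v ≠ 0` by irreducibility ★ `span_orbit_eq_top`); §2 on
`U(Φ₃)(L⁺_v)` (compact centre, every class admissible ★): the coefficients of every smooth functional are in `L²(G)` (★
`memLp_matrixCoeff_of_isSquareIntegrableModCenter_map`), a separating smooth functional exists (★ `exists_mem_contragredient_apply_ne_zero`), so an
`L²` datum exists and **`exists_formalDegree_of_isSquareIntegrable`**: every class `π` with `π.IsSquareIntegrable (νQv.map mk)` has a formal degree
`d(π) > 0` — realised by SOME datum and equal to the quotient of EVERY `L²` datum — the `d : {L² classes} → ℝ_{>0}` that socket #20P quantifies,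
now CONSTRUCTED (for the push-forward Haar measure on `G ∕ Z`; other Haar normalisations of `G ∕ Z` define the same `L²` classes).
HONEST LABEL: count-neutral; HC_CM is proved only modulo the 7 printed citations (2 remaining named inputs: hLiu418 = stmt-HodgeConjecture-24832, h413 =
stmt-HodgeConjecture-24833) until rung 0 closes; this `--supports` helper retires nothing by itself.

## References
* [HarishChandra1970] Harish-Chandra (notes by G. van Dijk), *Harmonic Analysis on Reductive p-adic Groups*, LNM 162 (1970), Part I §1 Theorem 1, p. 4.
* [Rogawski1990] J. D. Rogawski, *Automorphic Representations of Unitary Groups in Three Variables*, Ann. of Math. Stud. 123 (1990), §12.7 p. 194.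
-/

set_option autoImplicit false
-- the mandated namespace has the single-problem summit's repeated segment (`HodgeConjecture.HodgeConjecture`)
set_option linter.dupNamespace false

noncomputable section

open MeasureTheory NumberField IsDedekindDomain Filter Topology
open scoped ComplexConjugate
open Literature.NumberTheory.Automorphic Literature.NumberTheory.Automorphic.UnitaryGroup Literature.NumberTheory.Rogawski1990

namespace Summit.HodgeConjecture.HodgeConjecture.Cruxes.H413.K2E3FormalDegreeOfL2Class

/-! ## §1 Generic carriers: «`L²` ⇒ unitarisable» -/

section Generic

variable {G V : Type*} [Group G] [TopologicalSpace G] [IsTopologicalGroup G] [MeasurableSpace G] [BorelSpace G]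
  [AddCommGroup V] [Module ℂ V] {ρ : Representation ℂ G V}

/-- **«`L²` ⇒ UNITARISABLE».**  Let `ρ` be irreducible and smooth, `φ₀` a linear functional with `φ₀ v₀ ≠ 0`, all of whose coefficients `x ↦ φ₀ (ρ x v)` lie
in `L²(G, ν)` for a right-invariant Haar measure `ν`.  Then `B(v, w) := ∫ conj (φ₀ (ρ x v)) · φ₀ (ρ x w) dν(x)` is a `G`-INVARIANT POSITIVE-DEFINITE HERMITIAN
form on `V`: sesquilinear (Hölder `2 + 2` for the integrability), Hermitian, invariant (right invariance of `ν`: `φ₀ (ρ x (ρ g v)) = φ₀ (ρ (x g) v)`), and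
`B(v, v) = ∫ ‖φ₀ (ρ x v)‖² > 0` for `v ≠ 0` (the coefficient is continuous and not identically zero: the orbit of `v` spans `V` ★ `span_orbit_eq_top`, and
`φ₀ ≠ 0`; a Haar measure charges open sets). [cite: HarishChandra1970, Part I §1 Theorem 1] -/
theorem exists_invariantForm_of_memLp [ρ.IsIrreducible] (hsm : ρ.IsSmooth) (ν : Measure G) [ν.IsHaarMeasure] [ν.IsMulRightInvariant]
    {φ₀ : Module.Dual ℂ V} {v₀ : V} (hv₀ : φ₀ v₀ ≠ 0)
    (hL2 : ∀ v : V, MemLp (fun x => φ₀ (ρ x v)) 2 ν) :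
    ∃ B : V →ₗ⋆[ℂ] V →ₗ[ℂ] ℂ, B.IsSymm ∧ (∀ v : V, v ≠ 0 → 0 < (B v v).re) ∧
      (∀ (g : G) (v w : V), B (ρ g v) (ρ g w) = B v w) ∧
      ∀ v w : V, B v w = ∫ x, conj (φ₀ (ρ x v)) * φ₀ (ρ x w) ∂ν := by
  -- integrability of the products (Hölder `2 + 2`)
  have hL2c : ∀ v : V, MemLp (fun x => conj (φ₀ (ρ x v))) 2 ν := fun v =>
    (hL2 v).of_le (Complex.continuous_conj.comp_aestronglyMeasurable (hL2 v).1)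
      (Eventually.of_forall fun x => by simp only [Complex.norm_conj, le_refl])
  have hint : ∀ v w : V, Integrable (fun x => conj (φ₀ (ρ x v)) * φ₀ (ρ x w)) ν := fun v w =>
    (hL2c v).integrable_mul (hL2 w)
  -- the form
  let B : V →ₗ⋆[ℂ] V →ₗ[ℂ] ℂ := LinearMap.mk₂'ₛₗ (starRingEnd ℂ) (RingHom.id ℂ)
    (fun v w => ∫ x, conj (φ₀ (ρ x v)) * φ₀ (ρ x w) ∂ν)
    (fun v₁ v₂ w => by
      simp only [map_add, add_mul]
      exact integral_add (hint v₁ w) (hint v₂ w))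
    (fun z v w => by
      simp only [map_smul, smul_eq_mul, map_mul, mul_assoc]
      exact integral_const_mul _ _)
    (fun v w₁ w₂ => by
      simp only [map_add, mul_add]
      exact integral_add (hint v w₁) (hint v w₂))
    (fun z v w => by
      simp only [map_smul, smul_eq_mul, RingHom.id_apply, mul_left_comm _ z]
      exact integral_const_mul _ _)
  have hBapply : ∀ v w : V, B v w = ∫ x, conj (φ₀ (ρ x v)) * φ₀ (ρ x w) ∂ν := fun v w => by
    simp only [B, LinearMap.mk₂'ₛₗ_apply]
  refine ⟨B, ⟨fun v w => ?_⟩, fun v hv => ?_, fun g v w => ?_, hBapply⟩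
  · -- Hermitian
    rw [hBapply, hBapply, ← integral_conj]
    refine integral_congr_ae (Eventually.of_forall fun x => ?_)
    simp only [map_mul, Complex.conj_conj, mul_comm]
  · -- positive definite
    have hdiag : B v v = ((∫ x, ‖φ₀ (ρ x v)‖ ^ 2 ∂ν : ℝ) : ℂ) := by
      rw [hBapply, ← integral_complex_ofReal]
      refine integral_congr_ae (Eventually.of_forall fun x => ?_)
      simp only [Complex.conj_mul', Complex.ofReal_pow]
    rw [hdiag, Complex.ofReal_re]
    have hcont : Continuous fun x => φ₀ (ρ x v) := ρ.continuous_matrixCoeff φ₀ (hsm v)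
    have hint2 : Integrable (fun x => ‖φ₀ (ρ x v)‖ ^ 2) ν := (memLp_two_iff_integrable_sq_norm (hL2 v).1).1 (hL2 v)
    rw [integral_pos_iff_support_of_nonneg (fun x => sq_nonneg _) hint2]
    have hopen : IsOpen (Function.support fun x => ‖φ₀ (ρ x v)‖ ^ 2) := isOpen_ne_fun ((hcont.norm).pow 2) continuous_const
    -- some `x` with `φ₀ (ρ x v) ≠ 0`: otherwise `φ₀` kills the orbit of `v`, which spans `V`
    obtain ⟨x, hx⟩ : ∃ x : G, φ₀ (ρ x v) ≠ 0 := by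
      by_contra h
      push Not at h
      have hspan := Representation.IsIrreducible.span_orbit_eq_top ρ hv
      have hker : (⊤ : Submodule ℂ V) ≤ LinearMap.ker φ₀ := by
        rw [← hspan, Submodule.span_le]
        rintro _ ⟨g, rfl⟩
        exact h g
      exact hv₀ (hker Submodule.mem_top)
    have hxs : x ∈ Function.support fun x => ‖φ₀ (ρ x v)‖ ^ 2 := by
      rw [Function.mem_support]
      exact pow_ne_zero 2 (norm_ne_zero_iff.2 hx)
    exact hopen.measure_pos ν ⟨x, hxs⟩
  · -- invariant (right invariance of `ν`)
    rw [hBapply, hBapply]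
    have key : ∀ x, conj (φ₀ (ρ x (ρ g v))) * φ₀ (ρ x (ρ g w)) = (fun y => conj (φ₀ (ρ y v)) * φ₀ (ρ y w)) (x * g) := by
      intro x
      simp only [map_mul, Module.End.mul_apply]
    simp_rw [key]
    exact integral_mul_right_eq_self (fun y => conj (φ₀ (ρ y v)) * φ₀ (ρ y w)) g

end Generic

/-! ## §2 `U(Φ₃)(L⁺_v)`: an `L²` datum for every square-integrable class, and its formal degree -/

section CM

variable (L : Type) [Field L] [NumberField L] [IsCMField L] (v : HeightOneSpectrum (𝓞 ↥(maximalRealSubfield L)))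

set_option maxHeartbeats 1600000 in
/-- **AN `L²` DATUM FOR A SQUARE-INTEGRABLE REPRESENTATIVE.**  On `G = U(Φ₃)(L⁺_v)` (`v` non-split), if a representative `r` is square-integrable modulo the
centre for the push-forward measure `νQv.map mk` (★ `IsSquareIntegrableModCenter`, domination form), then `r.V` carries an invariant positive-definite
Hermitian form `B` ALL of whose coefficients `x ↦ B w (r.ρ x w′)` are in `L²(G, νQv)`, and `r.V ≠ 0`.  PROOF: a separating smooth functional `φ₀` (★
`exists_mem_contragredient_apply_ne_zero`, compact open subgroup ★ `exists_isCompact_openSubgroup`), its coefficients are `L²` (★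
`memLp_matrixCoeff_of_isSquareIntegrableModCenter_map`), §1 gives `B`; each `B w` is a smooth functional (★ `sesqForm_apply_mem_contragredient`), so its
coefficients are `L²` again. [cite: HarishChandra1970, Part I §1 Theorem 1] -/
theorem exists_l2Form_of_isSquareIntegrableModCenter
    [MeasurableSpace (Gqs L v)] [BorelSpace (Gqs L v)]
    [MeasurableSpace (Gqs L v ⧸ Subgroup.center (Gqs L v))] [BorelSpace (Gqs L v ⧸ Subgroup.center (Gqs L v))]
    (νQv : Measure (Gqs L v)) [νQv.IsHaarMeasure] [νQv.IsMulRightInvariant]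
    (r : SmoothIrrep (Gqs L v))
    (hL2 : r.ρ.IsSquareIntegrableModCenter (νQv.map (QuotientGroup.mk : Gqs L v → Gqs L v ⧸ Subgroup.center (Gqs L v)))) :
    ∃ (B : r.V →ₗ⋆[ℂ] r.V →ₗ[ℂ] ℂ), B.IsSymm ∧ (∀ w : r.V, w ≠ 0 → 0 < (B w w).re) ∧
      (∀ (g : Gqs L v) (w w' : r.V), B (r.ρ g w) (r.ρ g w') = B w w') ∧
      (∀ w w' : r.V, MemLp (fun x => B w (r.ρ x w')) 2 νQv) ∧ ∃ v₁ : r.V, v₁ ≠ 0 := by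
  haveI : NonarchimedeanGroup (Gqs L v) := F0P3cStCharTSScTracePackage.nonarchimedeanGroup_Gqs L v
  haveI : r.ρ.IsIrreducible := r.isIrreducible
  haveI : Nontrivial r.V := Representation.IsIrreducible.nontrivial r.ρ
  obtain ⟨v₀, hv₀⟩ := exists_ne (0 : r.V)
  obtain ⟨K₀, hK₀c⟩ := exists_isCompact_openSubgroup (G := Gqs L v)
  obtain ⟨φ₀, hφ₀, hφ₀v⟩ := exists_mem_contragredient_apply_ne_zero r.ρ r.isSmooth K₀.isOpen hK₀c hv₀
  have hφL2 : ∀ w : r.V, MemLp (fun x => φ₀ (r.ρ x w)) 2 νQv := fun w =>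
    Representation.memLp_matrixCoeff_of_isSquareIntegrableModCenter_map νQv r.isSmooth hL2 hφ₀ w
  obtain ⟨B, hBsymm, hBpos, hBinv, -⟩ := exists_invariantForm_of_memLp r.isSmooth νQv hφ₀v hφL2
  refine ⟨B, hBsymm, hBpos, hBinv, fun w w' => ?_, v₀, hv₀⟩
  exact Representation.memLp_matrixCoeff_of_isSquareIntegrableModCenter_map νQv r.isSmooth hL2
    (Representation.sesqForm_apply_mem_contragredient r.isSmooth B hBinv w) w'

set_option maxHeartbeats 1600000 in
/-- **THE FORMAL DEGREE OF A SQUARE-INTEGRABLE CLASS EXISTS AND IS CANONICAL.**  On `G = U(Φ₃)(L⁺_v)`, `v` non-split, `νQv` a Haar measure: every class `π`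
that is square-integrable modulo the centre (★ `IrrClass.IsSquareIntegrable` for the push-forward `νQv.map mk`) has a FORMAL DEGREE `d > 0`: there IS an
`L²` datum `(r, B, v₁)` of `π` (previous theorem), and for EVERY `L²` datum the quotient `(re B v₁ v₁)² ∕ ∫ ‖B (r.ρ x v₁) v₁‖² dνQv` and the value `f_{r,B,v₁}(1)`
of the normalised coefficient equal `d` (★ p855390 `exists_formalDegree_of_memLp`) — Harish-Chandra's «there exists a number `d(π) > 0` … depending only on
the normalization of the Haar measure» for the discrete series of `U(3)`, the `d(σ)` of socket #20P (DISC-PL). [cite: HarishChandra1970, Part I §1 Theorem 1]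
[cite: Rogawski1990, §12.7 Lemma 12.7.2 (proof) p. 194] -/
theorem exists_formalDegree_of_isSquareIntegrable
    (hns : ∀ w : PlacesOver L v, IsCMField.complexConj L • w.1 = w.1)
    [MeasurableSpace (Gqs L v)] [BorelSpace (Gqs L v)]
    [MeasurableSpace (Gqs L v ⧸ Subgroup.center (Gqs L v))] [BorelSpace (Gqs L v ⧸ Subgroup.center (Gqs L v))]
    (νQv : Measure (Gqs L v)) [νQv.IsHaarMeasure] [νQv.IsMulRightInvariant]
    (π : IrrClass (Gqs L v))
    (hπ : π.IsSquareIntegrable (νQv.map (QuotientGroup.mk : Gqs L v → Gqs L v ⧸ Subgroup.center (Gqs L v)))) :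
    ∃ d : ℝ, 0 < d ∧
      (∃ (r : SmoothIrrep (Gqs L v)) (_ : IrrClass.mk r = π) (B : r.V →ₗ⋆[ℂ] r.V →ₗ[ℂ] ℂ) (_ : B.IsSymm)
        (_ : ∀ w : r.V, w ≠ 0 → 0 < (B w w).re) (_ : ∀ (g : Gqs L v) (w w' : r.V), B (r.ρ g w) (r.ρ g w') = B w w')
        (_ : ∀ w w' : r.V, MemLp (fun x => B w (r.ρ x w')) 2 νQv) (v₁ : r.V), v₁ ≠ 0 ∧
          (B v₁ v₁).re ^ 2 / ∫ x, ‖B (r.ρ x v₁) v₁‖ ^ 2 ∂νQv = d) ∧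
      ∀ (r : SmoothIrrep (Gqs L v)), IrrClass.mk r = π →
        ∀ (B : r.V →ₗ⋆[ℂ] r.V →ₗ[ℂ] ℂ), B.IsSymm → (∀ w : r.V, w ≠ 0 → 0 < (B w w).re) →
          (∀ (g : Gqs L v) (w w' : r.V), B (r.ρ g w) (r.ρ g w') = B w w') →
          (∀ w w' : r.V, MemLp (fun x => B w (r.ρ x w')) 2 νQv) →
          ∀ v₁ : r.V, v₁ ≠ 0 →
            (B v₁ v₁).re ^ 2 / ∫ x, ‖B (r.ρ x v₁) v₁‖ ^ 2 ∂νQv = d ∧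
            ((((∫ x, ‖B (r.ρ x v₁) v₁‖ ^ 2 ∂νQv) / (B v₁ v₁).re : ℝ) : ℂ)⁻¹ • fun g => B (r.ρ g v₁) v₁) 1 = (d : ℂ) := by
  obtain ⟨d, hdpos, hd⟩ := K2E3SchurOrthogonalitySquareIntegrable.exists_formalDegree_of_memLp L v hns νQv π
  obtain ⟨r, hr, hrL2⟩ := hπ
  obtain ⟨B, hBsymm, hBpos, hBinv, hBL2, v₁, hv₁⟩ := exists_l2Form_of_isSquareIntegrableModCenter L v νQv r hrL2
  exact ⟨d, hdpos, ⟨r, hr, B, hBsymm, hBpos, hBinv, hBL2, v₁, hv₁, (hd r hr B hBsymm hBpos hBinv hBL2 v₁ hv₁).1⟩, hd⟩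

end CM

end Summit.HodgeConjecture.HodgeConjecture.Cruxes.H413.K2E3FormalDegreeOfL2Class

end
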